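import Mathlib
import Summits.Ventures.HodgeRepro2.A2TripleSumGysin

/-!
# A2 annex — Corollary A8.2: the hypotheses of the kernel form are jointly satisfiable

Non-vacuity check for `A2TripleSumGysin.weilCoordinate_gysinTriple_eq_zero` (Corollary A8.2 in its
final model form, route/T4-A2-p6.md v6 ll. 115–118): for every finite plane set `ι` with `|ι| ≥ 1`,
every Weil datum `(P₀, s)` and every plane `p`, the class `z₂ := E_{univ ∖ {p}}` (the product of the
plane classes of all planes but one) is

* non-zero (`ET_erase_ne_zero`),
* of degree `2|ι| − 2` (`ET_erase_mem_grading`; the model of `deg f_*c₂ = 22`),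
* and pairs to zero with every `e_{a,σ} ∧ e_{b,σ}`, `a ≠ b` in `P₀`
  (`integral_ET_erase_mul_gen_mul_gen`; the model of Proposition A8.1 for `c₂`),

so with `c ≡ 1` (all `c_p ≠ 0`) the hypotheses of the corollary hold simultaneously
(`corollaryA82_hypotheses_satisfiable`), and the corollary yields the vanishing of the Weil coordinates of
`m₃_*(z₁ ⊗ E_{univ ∖ {p}} ⊗ θ^{|P₀|})` for every `z₁` (`weilCoordinate_gysinTriple_ET_erase`).
This is a consistency witness for the hypotheses only; it says nothing about the geometric
`f_*c₂`.  Seat p6 (A2 owner), gen 16.  §8 (d): uses an L-value-free non-vanishing device: NO.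
-/

namespace Summit.Ventures.HodgeRepro2.A2TripleSumWitness

open WeilPlanes WeilIntegral WeilDetect WeilCoproduct A2TripleSumPairing A2TripleSumPairingDegree
  A2ModelDuality A2IntegralDegree A2TripleSumGysin

variable {ι : Type*} [DecidableEq ι] [Fintype ι]

omit [DecidableEq ι] [Fintype ι] in
/-- `planeList T` has length `2|T|`. -/
theorem length_planeList (T : Finset ι) : (planeList T).length = 2 * T.card := by
  simp [planeList, List.length_flatMap, Finset.length_toList, mul_comm]

omit [Fintype ι] in
/-- `E_T` lies in `⋀^{2|T|}`. -/
theorem ET_mem_grading (T : Finset ι) : ET T ∈ grading ι (2 * T.card) := by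
  rw [ET_eq_mono, ← length_planeList]
  exact mono_mem_grading _

omit [Fintype ι] in
/-- `E_T ≠ 0`. -/
theorem ET_ne_zero (T : Finset ι) : ET T ≠ 0 := by
  rw [ET_eq_mono]
  exact mono_ne_zero_of_nodup (nodup_planeList T)

/-- `E_{univ ∖ {p}}` has degree `2|ι| − 2`. -/
theorem ET_erase_mem_grading (p : ι) :
    ET (Finset.univ.erase p) ∈ grading ι (2 * Fintype.card ι - 2) := by
  have h := ET_mem_grading (Finset.univ.erase p)
  rwa [Finset.card_erase_of_mem (Finset.mem_univ p), Finset.card_univ, Nat.mul_sub, mul_one] at h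

/-- `E_{univ ∖ {p}} ≠ 0`. -/
theorem ET_erase_ne_zero (p : ι) : ET (Finset.univ.erase p) ≠ 0 := ET_ne_zero _

/-- `E_{univ ∖ {p}}` pairs to zero with every `e_{a,s} ∧ e_{b,s}`, `a ≠ b`: one of the two planes is
not `p`, and `E_T ∧ e_{a,s} = 0` for `a ∈ T`. -/
theorem integral_ET_erase_mul_gen_mul_gen (p : ι) (s : Bool) {a b : ι} (hab : a ≠ b) :
    integral (ET (Finset.univ.erase p) * (gen (a, s) * gen (b, s))) = 0 := by
  by_cases ha : a = p
  · subst ha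
    have hb : b ∈ Finset.univ.erase a := Finset.mem_erase.mpr ⟨fun h => hab h.symm, Finset.mem_univ b⟩
    rw [gen_mul_gen_swap, mul_neg, ← mul_assoc, ET_mul_gen_of_mem hb, zero_mul, neg_zero, map_zero]
  · have ha' : a ∈ Finset.univ.erase p := Finset.mem_erase.mpr ⟨ha, Finset.mem_univ a⟩
    rw [← mul_assoc, ET_mul_gen_of_mem ha', zero_mul, map_zero]

/-- **Joint satisfiability** of the hypotheses of `weilCoordinate_gysinTriple_eq_zero`: for
`|ι| ≥ 1` there is a non-zero `z₂` of degree `2|ι| − 2` pairing to zero with every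
`e_{a,s} ∧ e_{b,s}` (`a ≠ b` in `P₀`), and `c ≡ 1` has all `c_p ≠ 0`. -/
theorem corollaryA82_hypotheses_satisfiable (hι : 1 ≤ Fintype.card ι) (P₀ : Finset ι) (s : Bool) :
    ∃ z₂ : A ι, z₂ ≠ 0 ∧ z₂ ∈ grading ι (2 * Fintype.card ι - 2) ∧
      (∀ a ∈ P₀, ∀ b ∈ P₀, a ≠ b → integral (z₂ * (gen (a, s) * gen (b, s))) = 0) ∧
      ∀ p : ι, (fun _ : ι => (1 : ℂ)) p ≠ 0 := by
  haveI : Nonempty ι := Fintype.card_pos_iff.mp hι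
  obtain ⟨p⟩ := ‹Nonempty ι›
  exact ⟨ET (Finset.univ.erase p), ET_erase_ne_zero p, ET_erase_mem_grading p,
    fun _ _ _ _ hab => integral_ET_erase_mul_gen_mul_gen p s hab, fun _ => one_ne_zero⟩

/-- Corollary A8.2 instantiated on the witness: the Weil coordinates of
`m₃_*(z₁ ⊗ E_{univ ∖ {p}} ⊗ θ^{|P₀|})` (with `c ≡ 1`) vanish for every `z₁`. -/
theorem weilCoordinate_gysinTriple_ET_erase (hι : 1 ≤ Fintype.card ι) (P₀ : Finset ι) (s : Bool)
    (p : ι) (z₁ : A ι) :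
    integral (gysinTriple (integral ∘ₗ LinearMap.mulLeft ℂ z₁)
      (integral ∘ₗ LinearMap.mulLeft ℂ (ET (Finset.univ.erase p)))
      (psi (fun _ => (1 : ℂ)) P₀.card) * (ET (Finset.univ \ P₀) * weil P₀ s)) = 0 :=
  weilCoordinate_gysinTriple_eq_zero hι P₀ s (fun _ => 1) (fun _ => one_ne_zero) z₁
    (ET_erase_mem_grading p) (fun _ _ _ _ hab => integral_ET_erase_mul_gen_mul_gen p s hab)

end Summit.Ventures.HodgeRepro2.A2TripleSumWitness
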